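import Summits.NavierStokesRegularity.NavierStokesRegularity.Theorems.WakeRatchetEternalViscousRate.Negative.EternalViscousRateFalseOfViscousBlockDSSWaves
import Summits.NavierStokesRegularity.NavierStokesRegularity.Theorems.WakeRatchetEternalViscousRateStubNormalise
import Summits.NavierStokesRegularity.NavierStokesRegularity.Theorems.WakeRatchetEternalViscousRateDissipativeRung

/-!
# LINE g9-2 corollary — viscous block-DSS profiles are LOUD (small-dissipation-number DSS-Liouville)

Ideator ns-idea-1 g9 (card «monotone quantity hunt»).  MODEL lattice only; no summit is proved here.

The refuter's landed Negative lemma (`…Theorems.WakeRatchetViscDSS`, H = `ViscousBlockDSSWaves`) pins every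
non-trivial bounded admissible viscous block-DSS eternal solution `W_{n+p}(σ) = W_n(σ − T)` (`ν̂ > 0`) to the
a = 1 block ratio.  This file combines that pinning with LINE g9-2's PROVED rung (rate 2 in the dissipative
regime) and PROVED shell-shift covariance and shows:

`viscBlockDSS_eq_zero_of_belowThreshold` — if such a block-DSS solution (ε₀ ∈ (0,1], cancelling table) admits a
tail bound `Σ_{k≥0} E_k(σ) ≤ M` at base shell 0 with `M ≤ ν̂²/(128 (C_A+1)²)`, then `W ≡ 0`.

Equivalently: every H-profile has dissipation number `𝔇_0 = M/ν̂² > 1/(128 (C_A+1)²)` for EVERY valid tail bound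
at base shell 0 (and, by covariance, `𝔇_n > threshold` at every base shell): H-profiles are LOUD.  Mechanism: the
rung self-propagates up the tail (below threshold at base 0 ⇒ tail_j ≤ M (1+ε₀)^{-2j} for all j, because the
normalised bound at base j is (1+ε₀)^{j}·M(1+ε₀)^{-2j} ≤ M ≤ threshold), while block self-similarity with the
pinned ratio transports `tail_{jp}(σ + jT) = (1+ε₀)^{-jp} tail_0(σ)`; hence `tail_0 ≤ M (1+ε₀)^{-jp}` for every j,
so `tail_0 ≡ 0`, so shells `k ≥ 0` vanish, so by periodicity all shells vanish.
[cite: Tao2016AveragedNS, §4 Lemma 4.1 and §6.4; tree: physEnergy_succ_le, isEternalVisc_shift,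
WakeRatchetDSS.tail_shift, WakeRatchetViscDSS.viscBlockDSS_ratio]
-/

noncomputable section

set_option linter.dupNamespace false

namespace Summit.NavierStokesRegularity.NavierStokesRegularity.Cruxes.EternalViscousRate.DissipationEdge

open Set Filter Topology
open Literature.Analysis.FluidPDE Literature.Analysis.FluidPDE.TaoCascade
open Summit.NavierStokesRegularity.NavierStokesRegularity.Theorems

/-! ## Shell-shift covariance with a threshold -/

/-- At the covariant lag `s = 2n·log(1+ε₀)` and natural `n`, the factor is exactly `(1+ε₀)^n`. -/
theorem shiftFactor_natCast {ε₀ : ℝ} (hε : 0 < ε₀) (n : ℕ) :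
    shiftFactor ε₀ (n : ℤ) (2 * ((n : ℤ) : ℝ) * Real.log (1 + ε₀)) = (1 + ε₀) ^ n := by
  have hb : 0 < 1 + ε₀ := by linarith
  unfold shiftFactor
  rw [zpow_natCast, ← pow_mul, mul_comm n 2, pow_mul, bigLam_sq hε.le]
  have he : Real.exp (-(2 * (2 * ((n : ℤ) : ℝ) * Real.log (1 + ε₀)))) = (((1 + ε₀) ^ 4) ^ n)⁻¹ := by
    rw [Real.exp_neg]
    congr 1
    rw [show 2 * (2 * ((n : ℤ) : ℝ) * Real.log (1 + ε₀)) = (n : ℝ) * ((4 : ℕ) * Real.log (1 + ε₀)) by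
      push_cast; ring]
    rw [Real.exp_nat_mul, Real.exp_nat_mul, Real.exp_log hb]
  rw [he]
  have h4 : ((1 + ε₀) ^ 4) ^ n ≠ 0 := by positivity
  have h5 : ((1 + ε₀) ^ 5) ^ n = (1 + ε₀) ^ n * ((1 + ε₀) ^ 4) ^ n := by
    rw [← mul_pow]; congr 1; ring
  rw [h5, mul_assoc, mul_inv_cancel₀ h4, mul_one]

/-- The rate statement at base shell `n`, restricted to tail bounds `M ≤ θ`. -/
def RateBelow (a ε₀ : ℝ) (α : Fin 4 → Fin 4 → Fin 4 → ℤ × ℤ × ℤ → ℝ) (νh : ℝ) (n : ℤ) (θ : ℝ) : Prop :=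
  ∀ W : ℤ → ℝ → Em 4, IsEternalVisc ε₀ νh α W → UniformBound W → ∀ M : ℝ, M ≤ θ →
    (∀ σ : ℝ, ∑' k : ℕ, physEnergy ε₀ W (n + k) σ ≤ M) →
    ∀ σ : ℝ, ∑' k : ℕ, physEnergy ε₀ W (n + 1 + k) σ ≤ (1 + ε₀) ^ (-a) * M

/-- The PROVED rung in `RateBelow` form: rate 2 at base shell 0 below the dissipation-edge threshold. -/
theorem rateBelow_two_zero {ε₀ : ℝ} (hε : 0 < ε₀) (hε1 : ε₀ ≤ 1)
    {α : Fin 4 → Fin 4 → Fin 4 → ℤ × ℤ × ℤ → ℝ} (hc : IsCancellingCoeff α) {νh : ℝ} (hν : 0 < νh) :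
    RateBelow 2 ε₀ α νh 0 (edgeThreshold α νh) :=
  fun W hW hUB M hM hT σ => dissipativeRegime ε₀ hε hε1 α hc νh W hν hW hUB M hM hT σ

/-- **Threshold covariance.** A restricted rate statement at base shell `0` with threshold `θ` transports to
base shell `n` with threshold `θ / shiftFactor`. -/
theorem rateBelow_shift {a ε₀ : ℝ} (hε : 0 < ε₀) {α : Fin 4 → Fin 4 → Fin 4 → ℤ × ℤ × ℤ → ℝ} {νh θ : ℝ}
    (h0 : RateBelow a ε₀ α νh 0 θ) (n : ℤ) :
    RateBelow a ε₀ α νh n (θ / shiftFactor ε₀ n (2 * (n : ℝ) * Real.log (1 + ε₀))) := by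
  intro W hW hUB M hMθ hM σ
  have hvis := isEternalVisc_shift (m := 4) (by linarith : -1 < ε₀) hW n
  have hWt : ∀ j τ, (fun j τ => W (j + n) (τ + 2 * (n : ℝ) * Real.log (1 + ε₀))) j τ
      = W (j + n) (τ + 2 * (n : ℝ) * Real.log (1 + ε₀)) := fun _ _ => rfl
  have hUBt : UniformBound (fun j τ => W (j + n) (τ + 2 * (n : ℝ) * Real.log (1 + ε₀))) := by
    obtain ⟨B, hB⟩ := hUB
    exact ⟨B, fun k τ => hB _ _⟩
  have hρ := shiftFactor_pos hε n (2 * (n : ℝ) * Real.log (1 + ε₀))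
  have hMt : ∀ τ : ℝ, ∑' k : ℕ,
      physEnergy ε₀ (fun j τ => W (j + n) (τ + 2 * (n : ℝ) * Real.log (1 + ε₀))) (0 + k) τ
        ≤ shiftFactor ε₀ n (2 * (n : ℝ) * Real.log (1 + ε₀)) * M := by
    intro τ
    have hc : ∀ k : ℕ,
        physEnergy ε₀ (fun j τ => W (j + n) (τ + 2 * (n : ℝ) * Real.log (1 + ε₀))) (0 + k) τ
          = shiftFactor ε₀ n (2 * (n : ℝ) * Real.log (1 + ε₀))
            * physEnergy ε₀ W (n + k) (τ + 2 * (n : ℝ) * Real.log (1 + ε₀)) := by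
      intro k
      rw [physEnergy_shellShift hε hWt, show (0 : ℤ) + (k : ℤ) + n = n + k by ring]
    rw [tsum_congr hc, tsum_mul_left]
    exact mul_le_mul_of_nonneg_left (hM _) hρ.le
  have hMtθ : shiftFactor ε₀ n (2 * (n : ℝ) * Real.log (1 + ε₀)) * M ≤ θ := by
    rw [mul_comm]; exact (le_div_iff₀ hρ).mp hMθ
  have hconc := h0 _ hvis hUBt _ hMtθ hMt (σ - 2 * (n : ℝ) * Real.log (1 + ε₀))
  have hc' : ∀ k : ℕ,
      physEnergy ε₀ (fun j τ => W (j + n) (τ + 2 * (n : ℝ) * Real.log (1 + ε₀))) (0 + 1 + k)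
          (σ - 2 * (n : ℝ) * Real.log (1 + ε₀))
        = shiftFactor ε₀ n (2 * (n : ℝ) * Real.log (1 + ε₀)) * physEnergy ε₀ W (n + 1 + k) σ := by
    intro k
    rw [physEnergy_shellShift hε hWt, show (0 : ℤ) + 1 + (k : ℤ) + n = n + 1 + k by ring,
      show σ - 2 * (n : ℝ) * Real.log (1 + ε₀) + 2 * (n : ℝ) * Real.log (1 + ε₀) = σ by ring]
  rw [tsum_congr hc', tsum_mul_left] at hconc
  have h2 : shiftFactor ε₀ n (2 * (n : ℝ) * Real.log (1 + ε₀)) * ∑' k : ℕ, physEnergy ε₀ W (n + 1 + k) σ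
      ≤ shiftFactor ε₀ n (2 * (n : ℝ) * Real.log (1 + ε₀)) * ((1 + ε₀) ^ (-a) * M) := by
    calc _ ≤ (1 + ε₀) ^ (-a) * (shiftFactor ε₀ n (2 * (n : ℝ) * Real.log (1 + ε₀)) * M) := hconc
      _ = _ := by ring
  exact le_of_mul_le_mul_left h2 hρ

/-! ## The rung climbs the tail once it is below threshold -/

/-- **Self-propagation.** Below threshold at base shell 0, the tail contracts at rate 2 FOREVER:
`Σ_{k≥0} E_{j+k}(σ) ≤ M (1+ε₀)^{-2j}` for every `j ≥ 0`. -/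
theorem climb {ε₀ : ℝ} (hε : 0 < ε₀) (hε1 : ε₀ ≤ 1)
    {α : Fin 4 → Fin 4 → Fin 4 → ℤ × ℤ × ℤ → ℝ} (hc : IsCancellingCoeff α) {νh : ℝ} (hν : 0 < νh)
    {W : ℤ → ℝ → Em 4} (hW : IsEternalVisc ε₀ νh α W) (hUB : UniformBound W)
    {M : ℝ} (hMθ : M ≤ edgeThreshold α νh) (hT : ∀ σ : ℝ, ∑' k : ℕ, physEnergy ε₀ W (0 + k) σ ≤ M) :
    ∀ (j : ℕ) (σ : ℝ), ∑' k : ℕ, physEnergy ε₀ W ((j : ℤ) + k) σ ≤ M * (((1 + ε₀) ^ 2)⁻¹) ^ j := by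
  have hb : 0 < 1 + ε₀ := by linarith
  have hM0 : 0 ≤ M :=
    le_trans (tsum_nonneg fun k : ℕ => physEnergy_nonneg ε₀ W (0 + (k : ℤ)) 0) (hT 0)
  intro j
  induction j with
  | zero =>
    intro σ
    simp only [Nat.cast_zero, pow_zero, mul_one]
    exact hT σ
  | succ j ih =>
    intro σ
    have hR := rateBelow_shift hε (rateBelow_two_zero hε hε1 hc hν) (j : ℤ)
    rw [shiftFactor_natCast hε j] at hR
    -- the normalised bound at base j stays below threshold
    have hbound : M * (((1 + ε₀) ^ 2)⁻¹) ^ j ≤ edgeThreshold α νh / (1 + ε₀) ^ j := by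
      have hpj : 0 < (1 + ε₀) ^ j := by positivity
      rw [le_div_iff₀ hpj]
      have hle1 : (((1 + ε₀) ^ 2)⁻¹) ^ j * (1 + ε₀) ^ j ≤ 1 := by
        rw [← mul_pow]
        apply pow_le_one₀ (by positivity)
        rw [inv_mul_le_iff₀ (by positivity : (0 : ℝ) < (1 + ε₀) ^ 2), mul_one]
        nlinarith
      calc M * (((1 + ε₀) ^ 2)⁻¹) ^ j * (1 + ε₀) ^ j
          = M * ((((1 + ε₀) ^ 2)⁻¹) ^ j * (1 + ε₀) ^ j) := by ring
        _ ≤ M * 1 := mul_le_mul_of_nonneg_left hle1 hM0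
        _ ≤ edgeThreshold α νh := by rw [mul_one]; exact hMθ
    have h := hR W hW hUB _ hbound ih σ
    have hr : (1 + ε₀) ^ (-(2 : ℝ)) = ((1 + ε₀) ^ 2)⁻¹ := by
      rw [Real.rpow_neg hb.le, Real.rpow_two]
    rw [hr] at h
    have hidx : (((j + 1 : ℕ) : ℤ)) = (j : ℤ) + 1 := by push_cast; ring
    rw [hidx]
    calc _ ≤ ((1 + ε₀) ^ 2)⁻¹ * (M * (((1 + ε₀) ^ 2)⁻¹) ^ j) := h
      _ = M * (((1 + ε₀) ^ 2)⁻¹) ^ (j + 1) := by ring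

/-! ## Block self-similarity iterated -/

/-- Iterating the block shift: `W (n + j p) σ = W n (σ − j T)`. -/
theorem blockShift_iter {W : ℤ → ℝ → Em 4} {p : ℕ} {T : ℝ}
    (hD : ∀ (n : ℤ) (σ : ℝ), W (n + p) σ = W n (σ - T)) (j : ℕ) :
    ∀ (n : ℤ) (σ : ℝ), W (n + ((j * p : ℕ) : ℤ)) σ = W n (σ - (j : ℝ) * T) := by
  induction j with
  | zero => intro n σ; simp
  | succ j ih =>
    intro n σ
    have h1 : n + (((j + 1) * p : ℕ) : ℤ) = n + ((j * p : ℕ) : ℤ) + p := by push_cast; ring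
    rw [h1, hD, ih]
    congr 1
    push_cast
    ring

/-! ## The corollary -/

/-- **Viscous block-DSS profiles are loud (small-𝔇 DSS-Liouville).**  A uniformly bounded admissible viscous
eternal solution (`ν̂ > 0`, `ε₀ ∈ (0,1]`, cancelling table) that is block-self-similar, `W_{n+p}(σ) = W_n(σ − T)`
with `p ≥ 1`, and whose tail at base shell 0 admits a bound `M ≤ ν̂²/(128 (C_A+1)²)`, vanishes identically.
[cite: Tao2016AveragedNS, §4 Lemma 4.1 and §6.4; tree: WakeRatchetViscDSS.viscBlockDSS_ratio (refuter's Negative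
lemma file), WakeRatchetDSS.tail_shift; LINE g9-2 rung `dissipativeRegime`] -/
theorem viscBlockDSS_eq_zero_of_belowThreshold {ε₀ : ℝ} (hε : 0 < ε₀) (hε1 : ε₀ ≤ 1)
    {α : Fin 4 → Fin 4 → Fin 4 → ℤ × ℤ × ℤ → ℝ} (hc : IsCancellingCoeff α) {νh : ℝ} (hν : 0 < νh)
    {W : ℤ → ℝ → Em 4} (hW : IsEternalVisc ε₀ νh α W) (hUB : UniformBound W)
    {p : ℕ} (hp : 0 < p) {T : ℝ} (hD : ∀ (n : ℤ) (σ : ℝ), W (n + p) σ = W n (σ - T))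
    {M : ℝ} (hMθ : M ≤ edgeThreshold α νh) (hT : ∀ σ : ℝ, ∑' k : ℕ, physEnergy ε₀ W (0 + k) σ ≤ M) :
    ∀ (n : ℤ) (σ : ℝ), W n σ = 0 := by
  by_contra hne
  push Not at hne
  obtain ⟨n₀, σ₀, hne⟩ := hne
  have hb : 0 < 1 + ε₀ := by linarith
  have hM0 : 0 ≤ M :=
    le_trans (tsum_nonneg fun k : ℕ => physEnergy_nonneg ε₀ W (0 + (k : ℤ)) 0) (hT 0)
  have hclimb := climb hε hε1 hc hν hW hUB hMθ hT
  -- Step A: the base tail is bounded by M (1+ε₀)^{-jp} for every j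
  have hA : ∀ (j : ℕ) (σ : ℝ),
      ∑' k : ℕ, physEnergy ε₀ W (0 + k) σ ≤ M * ((1 + ε₀)⁻¹) ^ (j * p) := by
    intro j σ
    have hDj := blockShift_iter hD j
    have hratio := WakeRatchetViscDSS.viscBlockDSS_ratio hε.le hν hW hDj hne
    have hshift := WakeRatchetDSS.tail_shift hε hDj 0 (σ + (j : ℝ) * T)
    rw [hratio, show σ + (j : ℝ) * T - (j : ℝ) * T = σ by ring] at hshift
    have hcl := hclimb (j * p) (σ + (j : ℝ) * T)
    rw [show (((j * p : ℕ) : ℤ)) = 0 + ((j * p : ℕ) : ℤ) by ring, hshift] at hcl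
    have hρ : 0 < ((1 + ε₀)⁻¹) ^ (j * p) := by positivity
    have hr : (((1 + ε₀) ^ 2)⁻¹) ^ (j * p) = ((1 + ε₀)⁻¹) ^ (j * p) * ((1 + ε₀)⁻¹) ^ (j * p) := by
      rw [← mul_pow, sq, mul_inv]
    refine le_of_mul_le_mul_left ?_ hρ
    calc ((1 + ε₀)⁻¹) ^ (j * p) * ∑' k : ℕ, physEnergy ε₀ W (0 + k) σ
        ≤ M * (((1 + ε₀) ^ 2)⁻¹) ^ (j * p) := hcl
      _ = ((1 + ε₀)⁻¹) ^ (j * p) * (M * ((1 + ε₀)⁻¹) ^ (j * p)) := by rw [hr]; ring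
  -- Step B: hence the base tail vanishes
  have hB : ∀ σ : ℝ, ∑' k : ℕ, physEnergy ε₀ W (0 + k) σ = 0 := by
    intro σ
    have hq0 : 0 ≤ (1 + ε₀)⁻¹ := by positivity
    have hq1 : (1 + ε₀)⁻¹ < 1 := inv_lt_one_of_one_lt₀ (by linarith)
    have hqp : ((1 + ε₀)⁻¹) ^ p < 1 := pow_lt_one₀ hq0 hq1 hp.ne'
    have htend : Tendsto (fun j : ℕ => M * ((1 + ε₀)⁻¹) ^ (j * p)) atTop (𝓝 0) := by
      have hfun : (fun j : ℕ => M * ((1 + ε₀)⁻¹) ^ (j * p))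
          = fun j : ℕ => M * (((1 + ε₀)⁻¹) ^ p) ^ j := by
        funext j; rw [mul_comm j p, pow_mul]
      rw [hfun]
      simpa using (tendsto_pow_atTop_nhds_zero_of_lt_one (by positivity) hqp).const_mul M
    have hle : ∑' k : ℕ, physEnergy ε₀ W (0 + k) σ ≤ 0 := ge_of_tendsto' htend (fun j => hA j σ)
    exact le_antisymm hle (tsum_nonneg fun k : ℕ => physEnergy_nonneg ε₀ W (0 + (k : ℤ)) σ)
  -- Step C: every shell k ≥ 0 vanishes
  have hC : ∀ (k : ℕ) (σ : ℝ), W ((0 : ℤ) + k) σ = 0 := by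
    intro k σ
    obtain ⟨B, hBd⟩ := hUB
    have hsum := summable_physEnergy_tail hε hBd 0 σ
    have hEk : physEnergy ε₀ W (0 + k) σ = 0 := by
      refine le_antisymm ?_ (physEnergy_nonneg ε₀ W _ σ)
      rw [← hB σ]
      exact hsum.le_tsum k (fun i _ => physEnergy_nonneg ε₀ W _ σ)
    unfold physEnergy at hEk
    have h1 : 0 < bigLam ε₀ ^ ((0 : ℤ) + k) := zpow_pos (bigLam_pos (by linarith)) _
    have h2 : (bigLam ε₀ ^ ((0 : ℤ) + k))⁻¹ ^ 2 ≠ 0 := (pow_pos (inv_pos.mpr h1) 2).ne'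
    have h3 : Real.exp (2 * σ) ≠ 0 := (Real.exp_pos _).ne'
    rcases mul_eq_zero.mp hEk with h | h
    · exact absurd h h2
    rcases mul_eq_zero.mp h with h' | h'
    · exact absurd h' h3
    exact norm_eq_zero.mp (pow_eq_zero_iff (by norm_num : (2 : ℕ) ≠ 0) |>.mp h')
  -- Step D: periodicity moves any shell up to a non-negative one
  obtain ⟨j, hj⟩ : ∃ j : ℕ, 0 ≤ n₀ + ((j * p : ℕ) : ℤ) := by
    refine ⟨n₀.natAbs, ?_⟩
    have h1 : (n₀.natAbs : ℤ) ≤ ((n₀.natAbs * p : ℕ) : ℤ) := by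
      exact_mod_cast Nat.le_mul_of_pos_right _ hp
    have h2 : -n₀ ≤ (n₀.natAbs : ℤ) := by
      rw [Int.natCast_natAbs]; exact neg_le_abs n₀
    linarith
  obtain ⟨m, hm⟩ := Int.eq_ofNat_of_zero_le hj
  have hper := blockShift_iter hD j n₀ (σ₀ + (j : ℝ) * T)
  rw [show σ₀ + (j : ℝ) * T - (j : ℝ) * T = σ₀ by ring, hm] at hper
  have hz := hC m (σ₀ + (j : ℝ) * T)
  rw [zero_add] at hz
  exact hne (by rw [← hper]; exact hz)

end Summit.NavierStokesRegularity.NavierStokesRegularity.Cruxes.EternalViscousRate.DissipationEdge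

end
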